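import Summits.AtomisticToContinuum.Crystallization.Theorems.ChartedZeroExcessLayeredLatticeLiouvilleTE

/-!
# Zero-excess layered lattice Liouville — part TF (lens-2 g33): first prerequisites of the far-field pieces (FF) `TailForceSlavingP`, (A2), (E) of
part TB PROVED — the two `tsum`s of the tail force `tailForce ϱ S H Ψ x` converge absolutely (separated source configuration: model-far sources;
separated model set: Euclidean-far model sites from an arbitrary centre), so `tailForce` is the true tail and not a junk value; and Newton + Nash:
the source tail force is minus the near-field source force (`hasSum_tailForce_source`), whence between two separated Nash configurations the tail
force is a near-field difference (`tailForce_eq_near_sub_near`; for equilibrium layered charts `tailForce_layeredHom_eq_near_sub_near`, via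
`isSep_of_isClean`: clean configurations are `27/32`-separated).  Tree inputs: `summable_inv_pow_six`, `nash_force_balance`, `grid_injOn`,
`inv_pow_six_le_vWeight`, `summable_vWeight`, `norm_pairForce_le`, `inv_pow_add_le` (ChartedPlanarOrderNashForceBalance / …Layers).  §X: the
registration/graph data of (A0♭)/(A0♯) of part TE is INHABITED on the model itself (identity registration of an equilibrium chart; non-vacuity).
0 EQUIV; placeholder-free; no type-class declarations, custom syntax or option pragmas.
-/

noncomputable section

open scoped BigOperators InnerProductSpace RealInnerProductSpace
open MeasureTheory Set Metric Filter Topology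
open Summit.AtomisticToContinuum.Crystallization.Theorems.ChartedPlanarOrderRigidityDoor
  (E3 IsClean IsNash IsCharted IsEStarGSC VisibleGap PertRegime atomsIn siteEnergy eStar BindingSurface)
open Summit.AtomisticToContinuum.Crystallization.Theorems.ChartedPlanarOrderDensityDichotomy (μS IsSep nK nK_nonneg excess)
open Summit.AtomisticToContinuum.Crystallization.Theorems.ChartedPlanarOrderMesoCut (IsDoorSet NearHom LayeredHom EnvClose)
open Summit.AtomisticToContinuum.Crystallization.Theorems.OverbindingBudgetLiouvilleDictionary (NearHomBD)
open Summit.AtomisticToContinuum.Crystallization.Theorems.ChartedPlanarOrderDoorLayered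
  (TwoPeriodic DoorPeriodic PeriodicBulkGapDoor gap_and_pert_1_50_of_periodic NearHomL2BD nearHomL2BD_mono nearHomBD_of_nearHomL2BD
   sq_le_finsum_mem not_nearHomL2BD_singleton envClose_mono Layered layeredHom_eq_layered atomsIn_subset)
open Summit.AtomisticToContinuum.Crystallization.Theorems.ChartedPlanarOrderDoorLayeredOsc (IsTwoShellAffineGood DoorPeriodicOsc)
open Summit.AtomisticToContinuum.Crystallization.Theorems.ChartedPlanarOrderCleanScaleP
  (IsCleanP IsDoorSetP DoorPeriodicP isDoorSetP_mono doorPeriodic_of_doorPeriodicP isDoorSetP_one_iff doorPeriodicP_one_iff)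
open Summit.AtomisticToContinuum.Crystallization.Theorems.ChartedPlanarOrderProfileSlavingLJ (pairForce)
open Literature.MathematicalPhysics.StatisticalMechanics (haggLabel barlowOffset layerNormal IsHaggSeq triangularVec₁ triangularVec₂)

namespace Summit.AtomisticToContinuum.Crystallization.Theorems.ChartedZeroExcessLayeredLatticeLiouville

/-! ## §IX  (lens-2 g33) FIRST PREREQUISITES OF (FF)/(A2)/(E) PROVED: both `tsum`s of the tail force `tailForce ϱ S H Ψ x` converge — over the
`δ`-separated configuration (model-far sources, via Nash–force-balance's `summable_inv_pow_six`) and over a separated model set from an ARBITRARY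
centre (Euclidean-far model sites, via the grid injection `grid (min δ t)` and the product weight `vWeight`) — so `tailForce` is the true tail and
not a junk value ((FF)'s «why it might fail», first clause); and NEWTON + NASH: the source tail is minus the near-field source force
(`hasSum_tailForce_source`), so that between two Nash configurations the tail force is a NEAR-FIELD DIFFERENCE (`tailForce_eq_near_sub_near`) — the
algebraic identity from which (A2)'s energy identity starts. -/

section CleanSep

open Literature.Geometry.DiscreteGeometry (norm_of_mem_fccTwoShellPattern norm_of_mem_hcpTwoShellPattern)

/-- ★ **clean configurations are `27/32`-separated**: `(1/16, 9/10, 1)`-two-shell cleanliness at `x` registers every other atom within `3a/2` of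
`x` as a pattern point `a/16`-close to `x + a•A v` with `‖A v‖ = ‖v‖ ∈ {1, √2}`, so its distance to `x` is `≥ a − a/16 ≥ (15/16)(9/10) = 27/32`;
in particular the model set `LayeredHom L w` of an equilibrium chart (`IsEquilChart`: clean and Nash) is separated, so the MODEL lemmas below
apply to it. [this file, g33] -/
theorem isSep_of_isClean {H : Set E3} (hC : IsClean (μS H)) : IsSep (27 / 32) H := by
  have hatom : ∀ p : E3, (μS H) {p} ≠ 0 ↔ p ∈ H := fun p =>
    Literature.Probability.Process.count_restrict_singleton_ne_zero_iff H p
  intro x hx y hy hxy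
  obtain ⟨a, ha₁, ha₂, A, P, f, hP, hf, -, hcov⟩ := hC x ((hatom x).2 hx)
  rw [dist_comm]
  by_cases hnear : dist y x ≤ 3 / 2 * a
  · obtain ⟨v, hv, hfv⟩ := hcov y ((hatom y).2 hy) (Ne.symm hxy) hnear
    have hclose : dist (x + a • A v) y ≤ 1 / 16 * a := by
      rw [dist_comm, ← hfv]
      exact (hf v hv).2
    have hnorm : 1 ≤ ‖A v‖ := by
      rw [A.norm_map]
      rcases hP with rfl | rfl
      · rcases norm_of_mem_fccTwoShellPattern hv with h | h
        · rw [h]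
        · rw [h]; exact Real.one_le_sqrt.2 (by norm_num)
      · rcases norm_of_mem_hcpTwoShellPattern hv with h | h
        · rw [h]
        · rw [h]; exact Real.one_le_sqrt.2 (by norm_num)
    have ha0 : 0 ≤ a := by linarith
    have h1 : a ≤ dist (x + a • A v) x := by
      rw [dist_eq_norm, add_sub_cancel_left, norm_smul, Real.norm_of_nonneg ha0]
      nlinarith
    have h2 : dist (x + a • A v) x ≤ dist (x + a • A v) y + dist y x := dist_triangle _ _ _
    linarith
  · linarith [not_le.1 hnear]

/-- the model set of an equilibrium layered chart is `27/32`-separated (`isSep_of_isClean`). [this file, g33] -/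
theorem isSep_layeredHom_of_isEquilChart {a s Λ : ℝ} {L : E3 ≃L[ℝ] E3} {w : ℤ → E3} (hE : IsEquilChart a s Λ L w) :
    IsSep (27 / 32) (LayeredHom (L : E3 →L[ℝ] E3) w) :=
  isSep_of_isClean hE.2.2.2.1

end CleanSep

section TailSummable

open Summit.AtomisticToContinuum.Crystallization.Theorems.ChartedPlanarOrderNashForceBalance
  (Others le_norm_sub_of_others inv_pow_add_le norm_pairForce_le summable_inv_pow_six nash_force_balance grid grid_injOn vWeight summable_vWeight
   inv_pow_six_le_vWeight)

variable {δ : ℝ} {S T : Set E3} {x : E3}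

/-- the LJ pair forces on an atom of a `δ`-separated configuration from ALL other atoms are absolutely summable
(`‖pairForce‖ ≤ r⁻¹³ + r⁻⁷ ≤ (δ⁻⁷ + δ⁻¹)·r⁻⁶` and `summable_inv_pow_six`). [this file, g33] -/
theorem summable_pairForce_others (hδ : 0 < δ) (hS : IsSep δ S) (hx : x ∈ S) :
    Summable (fun q : Others S x => pairForce (x - (q : E3))) := by
  have h6 := summable_inv_pow_six hδ hS hx
  refine Summable.of_norm_bounded (g := fun q : Others S x => ((δ⁻¹) ^ 7 + δ⁻¹) * (‖x - (q : E3)‖⁻¹) ^ 6) (h6.mul_left _)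
    fun q => ?_
  have hq : δ ≤ ‖x - (q : E3)‖ := le_norm_sub_of_others hS hx q
  have hne : x ≠ (q : E3) := fun h => q.2.2 h.symm
  have h13 := inv_pow_add_le hδ hq 7
  have h7 := inv_pow_add_le hδ hq 1
  calc ‖pairForce (x - (q : E3))‖ ≤ (‖x - (q : E3)‖⁻¹) ^ 13 + (‖x - (q : E3)‖⁻¹) ^ 7 := norm_pairForce_le hne
    _ ≤ (δ⁻¹) ^ 7 * (‖x - (q : E3)‖⁻¹) ^ 6 + (δ⁻¹) ^ 1 * (‖x - (q : E3)‖⁻¹) ^ 6 :=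
        add_le_add (by simpa using h13) (by simpa using h7)
    _ = ((δ⁻¹) ^ 7 + δ⁻¹) * (‖x - (q : E3)‖⁻¹) ^ 6 := by ring

/-- ★ **the SOURCE sum of the tail force converges**: for an atom `x` of a `δ`-separated configuration `S`, any registration `Ψ` and any range
`ϱ ≥ 0`, the family `y ↦ pairForce (x − y)` over the atoms `y ∈ S` that are MODEL-far (`ϱ < dist (Ψ y) (Ψ x)`) — the first `tsum` of
`tailForce ϱ S H Ψ x` — is summable (model-far atoms are `≠ x`, so the family is a subfamily of `summable_pairForce_others`). [this file, g33] -/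
theorem summable_tailForce_source (hδ : 0 < δ) (hS : IsSep δ S) (hx : x ∈ S) {ϱ : ℝ} (hϱ : 0 ≤ ϱ) (Ψ : E3 → E3) :
    Summable (fun y : {y : E3 // y ∈ S ∧ ϱ < dist (Ψ y) (Ψ x)} => pairForce (x - (y : E3))) := by
  have hatom : ∀ p : E3, (μS S) {p} ≠ 0 ↔ p ∈ S := fun p =>
    Literature.Probability.Process.count_restrict_singleton_ne_zero_iff S p
  have hne : ∀ y : {y : E3 // y ∈ S ∧ ϱ < dist (Ψ y) (Ψ x)}, (y : E3) ≠ x := by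
    intro y h
    have hfar : ϱ < dist (Ψ (y : E3)) (Ψ x) := y.2.2
    rw [h, dist_self] at hfar
    exact absurd hfar (not_lt.2 hϱ)
  let ι : {y : E3 // y ∈ S ∧ ϱ < dist (Ψ y) (Ψ x)} → Others S x := fun y => ⟨(y : E3), ⟨(hatom y).2 y.2.1, hne y⟩⟩
  have hval : ∀ y, ((ι y : Others S x) : E3) = (y : E3) := fun y => rfl
  have hinj : Function.Injective ι := by
    intro y y' h
    have h' := congrArg (fun q : Others S x => (q : E3)) h
    simp only [hval] at h'
    exact Subtype.ext h'
  have hsum : Summable ((fun q : Others S x => pairForce (x - (q : E3))) ∘ ι) :=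
    (summable_pairForce_others hδ hS hx).comp_injective hinj
  refine hsum.congr fun y => ?_
  simp only [Function.comp_apply, hval]

/-- inverse sixth powers of the distances from an ARBITRARY centre `z` to the sites of a `δ`-separated set at distance `> t > 0` from `z` are
summable (grid injection at mesh `min δ t`). [this file, g33] -/
theorem summable_inv_pow_six_far (hδ : 0 < δ) (hT : IsSep δ T) (z : E3) {t : ℝ} (ht : 0 < t) :
    Summable (fun q : {q : E3 // q ∈ T ∧ t < dist q z} => (‖z - (q : E3)‖⁻¹) ^ 6) := by
  have hδ₀pos : 0 < min δ t := lt_min hδ ht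
  have hT₀ : IsSep (min δ t) T := fun p hp q hq hpq => (min_le_left _ _).trans (hT p hp q hq hpq)
  have hinj : Function.Injective (fun q : {q : E3 // q ∈ T ∧ t < dist q z} => grid (min δ t) (q : E3)) := by
    intro q q' h
    exact Subtype.ext (grid_injOn hδ₀pos hT₀ q.2.1 q'.2.1 h)
  have hv : Summable (fun q : {q : E3 // q ∈ T ∧ t < dist q z} =>
      (4 / min δ t) ^ 6 * vWeight (grid (min δ t) z) (grid (min δ t) (q : E3))) :=
    ((summable_vWeight (grid (min δ t) z)).mul_left ((4 / min δ t) ^ 6)).comp_injective hinj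
  refine Summable.of_nonneg_of_le (fun q => by positivity) (fun q => ?_) hv
  have hzq : min δ t ≤ ‖z - (q : E3)‖ := by
    have hfar := q.2.2
    rw [dist_eq_norm, norm_sub_rev] at hfar
    exact (min_le_right _ _).trans hfar.le
  exact inv_pow_six_le_vWeight hδ₀pos hzq

/-- the LJ pair forces at an ARBITRARY centre `z` from the sites of a `δ`-separated set at distance `> t > 0` are absolutely summable. [this file, g33] -/
theorem summable_pairForce_far (hδ : 0 < δ) (hT : IsSep δ T) (z : E3) {t : ℝ} (ht : 0 < t) :
    Summable (fun q : {q : E3 // q ∈ T ∧ t < dist q z} => pairForce (z - (q : E3))) := by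
  have h6 := summable_inv_pow_six_far hδ hT z ht
  refine Summable.of_norm_bounded (g := fun q : {q : E3 // q ∈ T ∧ t < dist q z} => ((t⁻¹) ^ 7 + t⁻¹) * (‖z - (q : E3)‖⁻¹) ^ 6)
    (h6.mul_left _) fun q => ?_
  have hzq' : t < ‖z - (q : E3)‖ := by
    have hfar := q.2.2
    rwa [dist_eq_norm, norm_sub_rev] at hfar
  have hzq : t ≤ ‖z - (q : E3)‖ := hzq'.le
  have hne : z ≠ (q : E3) := by
    intro h
    have h0 : z - (q : E3) = 0 := sub_eq_zero.2 h
    rw [h0, norm_zero] at hzq'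
    exact absurd hzq' (not_lt.2 ht.le)
  have h13 := inv_pow_add_le ht hzq 7
  have h7 := inv_pow_add_le ht hzq 1
  calc ‖pairForce (z - (q : E3))‖ ≤ (‖z - (q : E3)‖⁻¹) ^ 13 + (‖z - (q : E3)‖⁻¹) ^ 7 := norm_pairForce_le hne
    _ ≤ (t⁻¹) ^ 7 * (‖z - (q : E3)‖⁻¹) ^ 6 + (t⁻¹) ^ 1 * (‖z - (q : E3)‖⁻¹) ^ 6 :=
        add_le_add (by simpa using h13) (by simpa using h7)
    _ = ((t⁻¹) ^ 7 + t⁻¹) * (‖z - (q : E3)‖⁻¹) ^ 6 := by ring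

/-- ★ **the MODEL sum of the tail force converges**: for a `δ`-separated model set `H` (an equilibrium layered chart is clean, hence separated),
any `Ψ`, any atom `x` and any range `ϱ > 0`, the family `q ↦ pairForce (Ψ x − q)` over the model sites `q ∈ H` with `ϱ < dist q (Ψ x)` — the
second `tsum` of `tailForce ϱ S H Ψ x` — is summable. [this file, g33] -/
theorem summable_tailForce_model (hδ : 0 < δ) {H : Set E3} (hH : IsSep δ H) {ϱ : ℝ} (hϱ : 0 < ϱ) (Ψ : E3 → E3) (x : E3) :
    Summable (fun q : {q : E3 // q ∈ H ∧ ϱ < dist q (Ψ x)} => pairForce (Ψ x - (q : E3))) :=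
  summable_pairForce_far hδ hH (Ψ x) hϱ

/-- ★ **Newton's third law + Nash: the SOURCE tail force is MINUS the near-field source force.** For an atom `x` of a `δ`-separated NASH
configuration `S` (the total pair force on `x` vanishes, `nash_force_balance`), any registration `Ψ` and any range `ϱ ≥ 0`, the model-far source
family `y ↦ pairForce (x − y)` (`y ∈ S`, `ϱ < dist (Ψ y) (Ψ x)`; the first `tsum` of `tailForce`) sums to MINUS the sum over the model-near other
atoms (`y ∈ S`, `y ≠ x`, `dist (Ψ y) (Ψ x) ≤ ϱ`) — the far field an atom feels is read off its near field. [this file, g33] -/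
theorem hasSum_tailForce_source (hδ : 0 < δ) (hS : IsSep δ S) (hN : IsNash (μS S)) (hx : x ∈ S) {ϱ : ℝ} (hϱ : 0 ≤ ϱ)
    (Ψ : E3 → E3) :
    HasSum (fun y : {y : E3 // y ∈ S ∧ ϱ < dist (Ψ y) (Ψ x)} => pairForce (x - (y : E3)))
      (-∑' y : {y : E3 // y ∈ S ∧ y ≠ x ∧ dist (Ψ y) (Ψ x) ≤ ϱ}, pairForce (x - (y : E3))) := by
  have hatom : ∀ p : E3, (μS S) {p} ≠ 0 ↔ p ∈ S := fun p =>
    Literature.Probability.Process.count_restrict_singleton_ne_zero_iff S p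
  -- the full force family over the other atoms (sums to `0` by Nash) and its model-far / model-near splitting
  let f : Others S x → E3 := fun q => pairForce (x - (q : E3))
  have hf : HasSum f 0 := nash_force_balance hδ hS hN hx
  let s : Set (Others S x) := {q | ϱ < dist (Ψ (q : E3)) (Ψ x)}
  have ha : HasSum (f ∘ (↑) : s → E3) (∑' q : s, f q) := (hf.summable.subtype fun q => q ∈ s).hasSum
  have hb : HasSum (f ∘ (↑) : ↥sᶜ → E3) (∑' q : ↥sᶜ, f q) := (hf.summable.subtype fun q => q ∈ sᶜ).hasSum
  have hab : (∑' q : s, f q) + ∑' q : ↥sᶜ, f q = 0 := (ha.add_compl hb).unique hf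
  -- transport the far part to the `E3`-subtype of `tailForce`
  have hfar_ne : ∀ y : {y : E3 // y ∈ S ∧ ϱ < dist (Ψ y) (Ψ x)}, (y : E3) ≠ x := by
    intro y h
    have hfar : ϱ < dist (Ψ (y : E3)) (Ψ x) := y.2.2
    rw [h, dist_self] at hfar
    exact absurd hfar (not_lt.2 hϱ)
  let κ : {y : E3 // y ∈ S ∧ ϱ < dist (Ψ y) (Ψ x)} → s :=
    fun y => ⟨⟨(y : E3), ⟨(hatom y).2 y.2.1, hfar_ne y⟩⟩, (y.2.2 : ϱ < dist (Ψ (y : E3)) (Ψ x))⟩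
  have hκv : ∀ y, (((κ y : s) : Others S x) : E3) = (y : E3) := fun y => rfl
  have hκi : Function.Injective κ := by
    intro y y' h
    have h' := congrArg (fun q : s => ((q : Others S x) : E3)) h
    simp only [hκv] at h'
    exact Subtype.ext h'
  have hκs : ∀ q : s, ∃ y, κ y = q := by
    intro q
    have hq : ϱ < dist (Ψ ((q : Others S x) : E3)) (Ψ x) := q.2
    exact ⟨⟨((q : Others S x) : E3), ⟨(hatom _).1 q.1.2.1, hq⟩⟩, Subtype.ext (Subtype.ext rfl)⟩
  have hfar : HasSum (fun y : {y : E3 // y ∈ S ∧ ϱ < dist (Ψ y) (Ψ x)} => pairForce (x - (y : E3))) (∑' q : s, f q) := by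
    have h := (hκi.hasSum_iff (f := (f ∘ (↑) : s → E3)) (a := ∑' q : s, f q) fun q hq => (hq (hκs q)).elim).2 ha
    have hfun : (f ∘ (↑) : s → E3) ∘ κ = fun y : {y : E3 // y ∈ S ∧ ϱ < dist (Ψ y) (Ψ x)} => pairForce (x - (y : E3)) :=
      funext fun y => rfl
    rw [hfun] at h
    exact h
  -- transport the near part likewise
  let κ' : {y : E3 // y ∈ S ∧ y ≠ x ∧ dist (Ψ y) (Ψ x) ≤ ϱ} → ↥sᶜ :=
    fun y => ⟨⟨(y : E3), ⟨(hatom y).2 y.2.1, y.2.2.1⟩⟩,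
      Set.mem_compl (show ¬ϱ < dist (Ψ (y : E3)) (Ψ x) from not_lt.2 y.2.2.2)⟩
  have hκ'v : ∀ y, (((κ' y : ↥sᶜ) : Others S x) : E3) = (y : E3) := fun y => rfl
  have hκ'i : Function.Injective κ' := by
    intro y y' h
    have h' := congrArg (fun q : ↥sᶜ => ((q : Others S x) : E3)) h
    simp only [hκ'v] at h'
    exact Subtype.ext h'
  have hκ's : ∀ q : ↥sᶜ, ∃ y, κ' y = q := by
    intro q
    have hq : ¬ϱ < dist (Ψ ((q : Others S x) : E3)) (Ψ x) := q.2
    exact ⟨⟨((q : Others S x) : E3), ⟨(hatom _).1 q.1.2.1, q.1.2.2, not_lt.1 hq⟩⟩, Subtype.ext (Subtype.ext rfl)⟩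
  have hnear : HasSum (fun y : {y : E3 // y ∈ S ∧ y ≠ x ∧ dist (Ψ y) (Ψ x) ≤ ϱ} => pairForce (x - (y : E3)))
      (∑' q : ↥sᶜ, f q) := by
    have h := (hκ'i.hasSum_iff (f := (f ∘ (↑) : ↥sᶜ → E3)) (a := ∑' q : ↥sᶜ, f q) fun q hq => (hq (hκ's q)).elim).2 hb
    have hfun : (f ∘ (↑) : ↥sᶜ → E3) ∘ κ' =
        fun y : {y : E3 // y ∈ S ∧ y ≠ x ∧ dist (Ψ y) (Ψ x) ≤ ϱ} => pairForce (x - (y : E3)) := funext fun y => rfl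
    rw [hfun] at h
    exact h
  rw [hnear.tsum_eq, ← eq_neg_of_add_eq_zero_left hab]
  exact hfar

/-- `tsum` form of `hasSum_tailForce_source`: the first `tsum` of `tailForce ϱ S H Ψ x` equals minus the (finite-range) near-field source force.
[this file, g33] -/
theorem tsum_tailForce_source_eq_neg_near (hδ : 0 < δ) (hS : IsSep δ S) (hN : IsNash (μS S)) (hx : x ∈ S) {ϱ : ℝ}
    (hϱ : 0 ≤ ϱ) (Ψ : E3 → E3) :
    ∑' y : {y : E3 // y ∈ S ∧ ϱ < dist (Ψ y) (Ψ x)}, pairForce (x - (y : E3)) =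
      -∑' y : {y : E3 // y ∈ S ∧ y ≠ x ∧ dist (Ψ y) (Ψ x) ≤ ϱ}, pairForce (x - (y : E3)) :=
  (hasSum_tailForce_source hδ hS hN hx hϱ Ψ).tsum_eq

/-- ★ **the tail force is a NEAR-FIELD difference** (Newton + Nash on BOTH sides): for an atom `x` of a separated Nash configuration `S` registered
by `Ψ` into a separated Nash model set `H` with `Ψ x ∈ H` (equilibrium layered charts are Nash by `IsEquilChart`), and any range `ϱ ≥ 0`,
`tailForce ϱ S H Ψ x = (near model force at Ψ x from the model sites q ≠ Ψ x with dist q (Ψ x) ≤ ϱ) − (near source force at x from the atoms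
y ≠ x with dist (Ψ y) (Ψ x) ≤ ϱ)` — the algebraic starting point of (A2)'s energy identity (linearise the two near fields around the chart).
[this file, g33] -/
theorem tailForce_eq_near_sub_near (hδ : 0 < δ) (hS : IsSep δ S) (hN : IsNash (μS S)) {H : Set E3} {δ' : ℝ} (hδ' : 0 < δ')
    (hH : IsSep δ' H) (hNH : IsNash (μS H)) (hx : x ∈ S) {Ψ : E3 → E3} (hΨx : Ψ x ∈ H) {ϱ : ℝ} (hϱ : 0 ≤ ϱ) :
    tailForce ϱ S H Ψ x =
      (∑' q : {q : E3 // q ∈ H ∧ q ≠ Ψ x ∧ dist q (Ψ x) ≤ ϱ}, pairForce (Ψ x - (q : E3))) -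
        ∑' y : {y : E3 // y ∈ S ∧ y ≠ x ∧ dist (Ψ y) (Ψ x) ≤ ϱ}, pairForce (x - (y : E3)) := by
  have h₁ := tsum_tailForce_source_eq_neg_near hδ hS hN hx hϱ Ψ
  have h₂ : ∑' q : {q : E3 // q ∈ H ∧ ϱ < dist q (Ψ x)}, pairForce (Ψ x - (q : E3)) =
      -∑' q : {q : E3 // q ∈ H ∧ q ≠ Ψ x ∧ dist q (Ψ x) ≤ ϱ}, pairForce (Ψ x - (q : E3)) :=
    tsum_tailForce_source_eq_neg_near (x := Ψ x) hδ' hH hNH hΨx hϱ (fun z => z)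
  unfold tailForce
  rw [h₁, h₂]
  abel

/-- ★ `tailForce_eq_near_sub_near` for the model set of an EQUILIBRIUM LAYERED CHART (clean ⇒ `27/32`-separated, Nash by `IsEquilChart`) —
the form in which (FF) `TailForceSlavingP` / (A2) meet the tail force (their `Ψ` maps `S` into `LayeredHom L w` by `IsGlobalReg`). [this file, g33] -/
theorem tailForce_layeredHom_eq_near_sub_near (hδ : 0 < δ) (hS : IsSep δ S) (hN : IsNash (μS S)) {a s Λ : ℝ} {L : E3 ≃L[ℝ] E3}
    {w : ℤ → E3} (hE : IsEquilChart a s Λ L w) (hx : x ∈ S) {Ψ : E3 → E3} (hΨx : Ψ x ∈ LayeredHom (L : E3 →L[ℝ] E3) w) {ϱ : ℝ}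
    (hϱ : 0 ≤ ϱ) :
    tailForce ϱ S (LayeredHom (L : E3 →L[ℝ] E3) w) Ψ x =
      (∑' q : {q : E3 // q ∈ LayeredHom (L : E3 →L[ℝ] E3) w ∧ q ≠ Ψ x ∧ dist q (Ψ x) ≤ ϱ}, pairForce (Ψ x - (q : E3))) -
        ∑' y : {y : E3 // y ∈ S ∧ y ≠ x ∧ dist (Ψ y) (Ψ x) ≤ ϱ}, pairForce (x - (y : E3)) :=
  tailForce_eq_near_sub_near hδ hS hN (by norm_num) (isSep_layeredHom_of_isEquilChart hE) hE.2.2.2.2 hx hΨx hϱ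

/-- the MODEL `tsum` of the tail force converges for the model set of an equilibrium layered chart, any `Ψ`, `x`, `ϱ > 0`. [this file, g33] -/
theorem summable_tailForce_model_layeredHom {a s Λ : ℝ} {L : E3 ≃L[ℝ] E3} {w : ℤ → E3} (hE : IsEquilChart a s Λ L w) {ϱ : ℝ}
    (hϱ : 0 < ϱ) (Ψ : E3 → E3) (x : E3) :
    Summable (fun q : {q : E3 // q ∈ LayeredHom (L : E3 →L[ℝ] E3) w ∧ ϱ < dist q (Ψ x)} => pairForce (Ψ x - (q : E3))) :=
  summable_tailForce_model (by norm_num) (isSep_layeredHom_of_isEquilChart hE) hϱ Ψ x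

end TailSummable

/-! ## §X  (lens-2 g33) NON-VACUITY of the registration data of (A0♭)/(A0♯) ON THE MODEL ITSELF (critic row 565 (A)(2): hypothesis inhabitation
over a posited equilibrium chart).  An equilibrium layered chart, viewed as a configuration, carries ALL the data that (A0♭) `EquilChartGraphP` concludes
and (A0♯) `GraphLevelsP` assumes — registered to itself by the identity at level `0 ≤ κ` at every scale (part Q `isRegistered_self`,
`nearHomH1BDE_self`), globally graph-isomorphic to itself — and satisfies (A0)'s conclusion `IsGlobalReg Cg η R` for every `Cg, η ≥ 0`: the inner
implications of (A0♯) are not true by an uninhabited hypothesis, modulo the door-ness `IsDoorSetP` of a homogeneous equilibrium layered state (census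
TAG 174 family — recorded, not claimed, exactly as for part Q's `nearHomH1BDE_self`). -/

section SelfData

/-- the model registers ITSELF globally by the identity at every constant `Cg ≥ 0`, level `η ≥ 0`, scale `R > 0` ((A0)'s conclusion is inhabited on
the model). [this file, g33] -/
theorem isGlobalReg_self {Cg η R : ℝ} (hCg : 0 ≤ Cg) (hη : 0 ≤ η) (hR : 0 < R) (H : Set E3) :
    IsGlobalReg Cg η R H H (fun x => x) := by
  refine ⟨⟨fun x hx => hx, fun x _ y _ h => h, fun x hx => ⟨x, hx, rfl⟩⟩, fun x _ p _ h => ?_, fun x _ p _ h => ?_, fun D hD => ?_⟩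
  · dsimp only at h ⊢
    linarith
  · dsimp only at h ⊢
    linarith
  · have hDR : 0 ≤ D / R := div_nonneg (hR.le.trans hD) hR.le
    exact ⟨fun _ => 0, (isRegistered_self 4 D (atomsIn_subset H D)).mono (mul_nonneg (mul_nonneg hCg hDR) hη)⟩

/-- ★ an EQUILIBRIUM layered chart carries, as a configuration, the whole registration/graph data of (A0♭)'s conclusion and (A0♯)'s hypotheses at
every level `κ ≥ 0` and scale `R`: registered-flat under itself at every scale `D ≥ R` (`NearHomH1BDE … κ 4 D`), registered at scale `R` at level
`κ`, and globally graph-isomorphic to itself with the two-sided `4 ↦ 8` tear-freeness (all by the identity). [this file, g33] -/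
theorem equilChartGraph_data_self {a s Λ : ℝ} {L : E3 ≃L[ℝ] E3} {w : ℤ → E3} (hE : IsEquilChart a s Λ L w) {κ : ℝ} (hκ : 0 ≤ κ) (R : ℝ) :
    (∀ D : ℝ, R ≤ D →
        NearHomH1BDE a s Λ κ 4 D (LayeredHom (L : E3 →L[ℝ] E3) w) (atomsIn (μS (LayeredHom (L : E3 →L[ℝ] E3) w)) 0 D)) ∧
      (∃ (Ψ : E3 → E3) (τ : E3 → ℝ), IsRegistered κ 4 R (LayeredHom (L : E3 →L[ℝ] E3) w)
        (atomsIn (μS (LayeredHom (L : E3 →L[ℝ] E3) w)) 0 R) (LayeredHom (L : E3 →L[ℝ] E3) w) Ψ τ) ∧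
      ∃ Ψ₀ : E3 → E3, Set.BijOn Ψ₀ (LayeredHom (L : E3 →L[ℝ] E3) w) (LayeredHom (L : E3 →L[ℝ] E3) w) ∧
        (∀ x ∈ LayeredHom (L : E3 →L[ℝ] E3) w, ∀ p ∈ LayeredHom (L : E3 →L[ℝ] E3) w, dist p x ≤ 4 → dist (Ψ₀ p) (Ψ₀ x) ≤ 8) ∧
        (∀ x ∈ LayeredHom (L : E3 →L[ℝ] E3) w, ∀ p ∈ LayeredHom (L : E3 →L[ℝ] E3) w, dist (Ψ₀ p) (Ψ₀ x) ≤ 4 → dist p x ≤ 8) := by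
  refine ⟨fun D _ => nearHomH1BDE_mono hκ (nearHomH1BDE_self hE (atomsIn_subset _ D)),
    ⟨fun x => x, fun _ => 0, (isRegistered_self 4 R (atomsIn_subset _ R)).mono hκ⟩,
    fun x => x, ⟨fun x hx => hx, fun x _ y _ h => h, fun x hx => ⟨x, hx, rfl⟩⟩, fun x _ p _ h => ?_, fun x _ p _ h => ?_⟩
  · dsimp only at h ⊢
    linarith
  · dsimp only at h ⊢
    linarith

end SelfData


end Summit.AtomisticToContinuum.Crystallization.Theorems.ChartedZeroExcessLayeredLatticeLiouville

end
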